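import Summits.Ventures.CertifiedManyBodySolver.Transport.LTIPrimalHubbardChainEntTLM
import Summits.Ventures.CertifiedManyBodySolver.Transport.LTIPrimalHubbardChainKSDN
import Summits.Ventures.CertifiedManyBodySolver.Statement

/-!
# Row predicates for the lane-B / ENT WINDOW-MARGINAL by-value nodes of the Hubbard chain (`t = 1`):
# named node shapes with rational slots, their M1 cells BY NAME, and the solver-free edges between them

HONEST FRAMING: first certified bounds; not a superconductivity verdict; every number certified or labelled float.

WHAT THIS FILE IS (speedrun cell sr-mbsolver, LIT team lit-1 gen-6; LEAD D-19 r113 (a) / r115). The tree proves four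
TRANSPORT theorems for a certificate about the `k = n + 3`-site window marginal `ρ : Op (PolySite (chainWindow (-1) (n+1))) 4`
of the Hubbard chain (Jordan–Wigner / occupation basis of `HubbardJordanWigner`, local dimension `4`):

* `Transport.lti_primal_chainWindow_energyDensity[At]_ge` (`LTIPrimalHubbardChainWindow`, lit-1 gen-5): the lane-B `lti(n)` node
  in MEAN-ENERGY form (objective `toSpin (Γ(incl) E_Φ)`, per-spin density of site `0`);
* `Transport.lti_primal_chainWindow_energyDensity[At]_ge_ksdn` (`LTIPrimalHubbardChainKSDN`): the same node in the LITERAL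
  FORMAT-ltisdp form (bond objective on the first bond with `U` on its left site, TOTAL density of the first site);
* `Transport.ent_primal_chainWindow_energyDensity[At]_ge` (`LTIPrimalHubbardChainEnt`, lit-1 gen-6 on lit-4's
  `WindowEntropyIncrement`): the mean-energy node PLUS the entropy row `0 ≤ S(ρ) − S(tr_{n+1} ρ)` (weak monotonicity under
  local translation invariance, [FawziFawziScalet2024Entropy, Thm 4.1]);
* `Transport.ent_tlm_chainWindow_energyDensity[At]_ge` (`LTIPrimalHubbardChainEntTLM`): the entropy node in the LITERAL shape of
  op-08's `tl_marginal` problem files (objective `toSpin (tlmObjective 1 U n)` = bond-averaged `h_avg`, ONE site-averaged total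
  density row `Re tr(toSpin (tlmDensity n) ρ) = filling`).

This file names the four hypothesis shapes as ROW PREDICATES with rational slots — `LTIChainNode U n ν lo`,
`LTIChainKSDNNode U n ν lo`, `EntChainNode U n ν lo`, `EntTLMChainNode U n ν lo` (binder lists VERBATIM those of the transport
theorems at `t = 1`, density target `((ν : ℚ) : ℝ)`, bound `((lo : ℚ) : ℝ)`) — so that a `Certificates/` instance of a lane-B or
ENT row is `@[conjecture] def cert_… : Prop := EntTLMChainNode 8 2 1 lo` plus ONE LINE `cert_….m1EnergyLowerRow hU`, and a
referee's by-name audit compares a predicate NAME and four numbers with the problem file (`U`, `k = n + 3`, filling, bound).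
It proves the M1 cells BY NAME (`….m1EnergyLowerRow`, `….m1DopedEnergyLowerRow`), the ring forms (`….le_energyPerSite`), and
the solver-free edges: monotonicity in the slot `lo`, `LTIChainNode → EntChainNode` (an `lti(n)` certificate is an ENT
certificate), `EntTLMChainNode U n (2ν) lo → EntChainNode U n ν lo` (under the LTI row the `tl_marginal` objective and density
have the mean-energy expectations: `Transport.trace_tlmObjective_eq_of_lti`, `Transport.trace_tlmDensity_eq_of_lti`).

NON-VACUITY is a tree theorem: the node antecedents are satisfied, on every ring `ℤ/Lℤ` long enough, by the window marginal of
the sector ground-state projector (`Transport.exists_lti_feasible_chain`, `Transport.exists_lti_ent_feasible_chainWindow`), whose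
objective value is `E₀(ring L, N)/L`; hence a typed slot `lo` is at most every such ring energy (`….le_energyPerSite`).

NOTHING IS ASSERTED HERE: every bound-valued statement is a `def … : Prop` or takes node predicates as hypotheses; nodes are
instantiated only under `Certificates/` from certificate files. No `sorry`, no new axiom, no named fact.
[cite: KullEtAl2024, §II.B, §VI.B] [cite: FawziFawziScalet2024Entropy, Theorem 4.1] [cite: Han2020Bootstrap, §2]
-/

noncomputable section

open Matrix Complex Filter Topology
open scoped ComplexOrder BigOperators
open Literature.Probability.LatticeModels
open Literature.MathematicalPhysics.QuantumLattice
open Literature.MathematicalPhysics.QuantumLattice.HubbardWave0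
open Literature.MathematicalPhysics.QuantumLattice.ThermodynamicLimit
open Literature.MathematicalPhysics.QuantumLattice.JordanWigner
open Literature.MathematicalPhysics.QuantumManyBody.StateRelaxation
open Literature.InformationTheory.Entropy (vonNeumannEntropy)
open Summit.Ventures.CertifiedManyBodySolver.Transport

namespace Summit.Ventures.CertifiedManyBodySolver

/-! ## §A  The four node predicates (window `{-1, 0, …, n+1}`, `k = n + 3` sites, `t = 1`) -/

section Nodes

/-- **Lane-B `lti(n)` node, MEAN-ENERGY form** (the `hclaim` of `Transport.lti_primal_chainWindow_energyDensity[At]_ge` at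
`t = 1`): for every window variable `ρ : Op (PolySite {-1, …, n+1}) 4` with `ρ ⪰ 0`, `tr ρ = 1`, the local-translation-invariance
row `tr_{-1} ρ = tr_{n+1} ρ` (as an equality of pulled-back marginals), the `(N↑, N↓)`-sector zeros, the per-spin density of site
`0` equal to `ν`, real entries bounded by one: `lo ≤ Re tr(toSpin (Γ(incl_{{-1,0,1}}) E_Φ) ρ)` (`E_Φ` = the mean energy observable
of `hubbardFermionInteraction 1 1 U`). [cite: KullEtAl2024, §II.B, §VI.B] -/
def LTIChainNode (U : ℝ) (n : ℕ) (ν lo : ℚ) : Prop :=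
  ∀ ρ : Op (PolySite (chainWindow (-1) ((n : ℤ) + 1))) 4, ρ.PosSemidef → ρ.trace = 1 →
    spinPartialTrace ((PolySite.affEmb 1 (unitVec 0) (chainWindow (-1) (n : ℤ))).trans
        (PolySite.incl (affShiftSet_chainWindow_subset (-1) (n : ℤ)))) ρ =
      spinPartialTrace (PolySite.incl (chainWindow_mono_right (-1) (by omega : (n : ℤ) ≤ n + 1))) ρ →
    (∀ σ : Fin 2, ∀ k k' : TensorIndex (PolySite (chainWindow (-1) ((n : ℤ) + 1))) 4,
      (∑ x, if σ ∈ siteOcc (k x) then 1 else 0 : ℕ) ≠ (∑ x, if σ ∈ siteOcc (k' x) then 1 else 0 : ℕ) → ρ k k' = 0) →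
    (∀ σ : Fin 2, ((toSpin (nAt 0 (zero_mem_chainWindow (by omega : (0 : ℤ) ≤ n + 1)) σ) * ρ).trace).re = ((ν : ℚ) : ℝ)) →
    (∀ k k' : TensorIndex (PolySite (chainWindow (-1) ((n : ℤ) + 1))) 4, starRingEnd ℂ (ρ k k') = ρ k k') →
    (∀ k k' : TensorIndex (PolySite (chainWindow (-1) ((n : ℤ) + 1))) 4, ‖ρ k k'‖ ≤ 1) →
    ((lo : ℚ) : ℝ) ≤ ((toSpin (fermionEmbed (PolySite.incl (thicken_zero_one_subset_chainWindow (by omega : (1 : ℤ) ≤ n + 1)))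
      ((hubbardFermionInteraction 1 1 U).meanEnergyObs 1)) * ρ).trace).re

/-- **Lane-B `lti(n)` node, FORMAT-ltisdp form** (the `hclaim` of `Transport.lti_primal_chainWindow_energyDensity[At]_ge_ksdn`
at `t = 1`; model `hubbard_jw(U)`, FORMAT-ltisdp §1/§4.1): same rows, but the density row is the TOTAL density of the first
site `-1` equal to `ν`, and the objective is the first BOND `U n_{-1↑}n_{-1↓} − Σ_σ (c†_{-1σ}c_{0σ} + c†_{0σ}c_{-1σ})`.
[cite: KullEtAl2024, §II.B eq. (locTIn), §VI.B] -/
def LTIChainKSDNNode (U : ℝ) (n : ℕ) (ν lo : ℚ) : Prop :=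
  ∀ ρ : Op (PolySite (chainWindow (-1) ((n : ℤ) + 1))) 4, ρ.PosSemidef → ρ.trace = 1 →
    spinPartialTrace ((PolySite.affEmb 1 (unitVec 0) (chainWindow (-1) (n : ℤ))).trans
        (PolySite.incl (affShiftSet_chainWindow_subset (-1) (n : ℤ)))) ρ =
      spinPartialTrace (PolySite.incl (chainWindow_mono_right (-1) (by omega : (n : ℤ) ≤ n + 1))) ρ →
    (∀ σ : Fin 2, ∀ k k' : TensorIndex (PolySite (chainWindow (-1) ((n : ℤ) + 1))) 4,
      (∑ x, if σ ∈ siteOcc (k x) then 1 else 0 : ℕ) ≠ (∑ x, if σ ∈ siteOcc (k' x) then 1 else 0 : ℕ) → ρ k k' = 0) →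
    ((toSpin (nAt (-unitVec 0) (neg_unitVec_mem_chainWindow (by omega : (-1 : ℤ) ≤ n + 1)) 0 +
        nAt (-unitVec 0) (neg_unitVec_mem_chainWindow (by omega : (-1 : ℤ) ≤ n + 1)) 1) * ρ).trace).re = ((ν : ℚ) : ℝ) →
    (∀ k k' : TensorIndex (PolySite (chainWindow (-1) ((n : ℤ) + 1))) 4, starRingEnd ℂ (ρ k k') = ρ k k') →
    (∀ k k' : TensorIndex (PolySite (chainWindow (-1) ((n : ℤ) + 1))) 4, ‖ρ k k'‖ ≤ 1) →
    ((lo : ℚ) : ℝ) ≤ ((toSpin ((U : ℂ) • (nAt (-unitVec 0) (neg_unitVec_mem_chainWindow (by omega : (-1 : ℤ) ≤ n + 1)) 0 *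
          nAt (-unitVec 0) (neg_unitVec_mem_chainWindow (by omega : (-1 : ℤ) ≤ n + 1)) 1) +
        (-((1 : ℝ) : ℂ)) • ∑ σ : Fin 2,
          ((cAt (-unitVec 0) (neg_unitVec_mem_chainWindow (by omega : (-1 : ℤ) ≤ n + 1)) σ)ᴴ *
              cAt 0 (zero_mem_chainWindow (by omega : (0 : ℤ) ≤ n + 1)) σ +
            (cAt 0 (zero_mem_chainWindow (by omega : (0 : ℤ) ≤ n + 1)) σ)ᴴ *
              cAt (-unitVec 0) (neg_unitVec_mem_chainWindow (by omega : (-1 : ℤ) ≤ n + 1)) σ)) * ρ).trace).re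

/-- **ENT node, mean-energy form** (the `hclaim` of `Transport.ent_primal_chainWindow_energyDensity[At]_ge` at `t = 1`): the
`LTIChainNode` rows plus the entropy row `0 ≤ S(ρ) − S(tr_{n+1} ρ)` (`vonNeumannEntropy`; weak monotonicity under the LTI
row, [FawziFawziScalet2024Entropy, Thm 4.1]); conclusion `lo ≤ Re tr(toSpin (Γ(incl) E_Φ) ρ)`.
[cite: KullEtAl2024, §II.B, §VI.B] [cite: FawziFawziScalet2024Entropy, Theorem 4.1] -/
def EntChainNode (U : ℝ) (n : ℕ) (ν lo : ℚ) : Prop :=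
  ∀ ρ : Op (PolySite (chainWindow (-1) ((n : ℤ) + 1))) 4, ρ.PosSemidef → ρ.trace = 1 →
    spinPartialTrace ((PolySite.affEmb 1 (unitVec 0) (chainWindow (-1) (n : ℤ))).trans
        (PolySite.incl (affShiftSet_chainWindow_subset (-1) (n : ℤ)))) ρ =
      spinPartialTrace (PolySite.incl (chainWindow_mono_right (-1) (by omega : (n : ℤ) ≤ n + 1))) ρ →
    (∀ σ : Fin 2, ∀ k k' : TensorIndex (PolySite (chainWindow (-1) ((n : ℤ) + 1))) 4,
      (∑ x, if σ ∈ siteOcc (k x) then 1 else 0 : ℕ) ≠ (∑ x, if σ ∈ siteOcc (k' x) then 1 else 0 : ℕ) → ρ k k' = 0) →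
    (∀ σ : Fin 2, ((toSpin (nAt 0 (zero_mem_chainWindow (by omega : (0 : ℤ) ≤ n + 1)) σ) * ρ).trace).re = ((ν : ℚ) : ℝ)) →
    (∀ k k' : TensorIndex (PolySite (chainWindow (-1) ((n : ℤ) + 1))) 4, starRingEnd ℂ (ρ k k') = ρ k k') →
    (∀ k k' : TensorIndex (PolySite (chainWindow (-1) ((n : ℤ) + 1))) 4, ‖ρ k k'‖ ≤ 1) →
    0 ≤ vonNeumannEntropy ρ -
      vonNeumannEntropy (spinPartialTrace (PolySite.incl (chainWindow_mono_right (-1) (by omega : (n : ℤ) ≤ n + 1))) ρ) →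
    ((lo : ℚ) : ℝ) ≤ ((toSpin (fermionEmbed (PolySite.incl (thicken_zero_one_subset_chainWindow (by omega : (1 : ℤ) ≤ n + 1)))
      ((hubbardFermionInteraction 1 1 U).meanEnergyObs 1)) * ρ).trace).re

/-- **ENT node, `tl_marginal` form** (the `hclaim` of `Transport.ent_tlm_chainWindow_energyDensity[At]_ge` at `t = 1`; op-08's
formulation-B problem files `hub_chainTL_rdm<k>_t1_U<U>_n<ν>_ent…`, `G`-free issue, LEAD r115): rows `ρ ⪰ 0` blockwise in the
`(N↑, N↓)` sectors (PSD + sector zeros), `tr ρ = 1`, LTI `tr_first ρ = tr_last ρ`, the ONE site-averaged total density row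
`Re tr(toSpin (tlmDensity n) ρ) = ν` (`ν` = filling, particles per site), real symmetric entries bounded by one (the
`⟨transpose⟩` identification and `|y| ≤ 1`), the entropy row; conclusion `lo ≤ Re tr(toSpin (tlmObjective 1 U n) ρ)`
(`h_avg`, bond-averaged). [cite: KullEtAl2024, §II.B, §VI.B] [cite: FawziFawziScalet2024Entropy, Theorem 4.1] -/
def EntTLMChainNode (U : ℝ) (n : ℕ) (ν lo : ℚ) : Prop :=
  ∀ ρ : Op (PolySite (chainWindow (-1) ((n : ℤ) + 1))) 4, ρ.PosSemidef → ρ.trace = 1 →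
    spinPartialTrace ((PolySite.affEmb 1 (unitVec 0) (chainWindow (-1) (n : ℤ))).trans
        (PolySite.incl (affShiftSet_chainWindow_subset (-1) (n : ℤ)))) ρ =
      spinPartialTrace (PolySite.incl (chainWindow_mono_right (-1) (by omega : (n : ℤ) ≤ n + 1))) ρ →
    (∀ σ : Fin 2, ∀ k k' : TensorIndex (PolySite (chainWindow (-1) ((n : ℤ) + 1))) 4,
      (∑ x, if σ ∈ siteOcc (k x) then 1 else 0 : ℕ) ≠ (∑ x, if σ ∈ siteOcc (k' x) then 1 else 0 : ℕ) → ρ k k' = 0) →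
    ((toSpin (tlmDensity n) * ρ).trace).re = ((ν : ℚ) : ℝ) →
    (∀ k k' : TensorIndex (PolySite (chainWindow (-1) ((n : ℤ) + 1))) 4, starRingEnd ℂ (ρ k k') = ρ k k') →
    (∀ k k' : TensorIndex (PolySite (chainWindow (-1) ((n : ℤ) + 1))) 4, ‖ρ k k'‖ ≤ 1) →
    0 ≤ vonNeumannEntropy ρ -
      vonNeumannEntropy (spinPartialTrace (PolySite.incl (chainWindow_mono_right (-1) (by omega : (n : ℤ) ≤ n + 1))) ρ) →
    ((lo : ℚ) : ℝ) ≤ ((toSpin (tlmObjective 1 U n) * ρ).trace).re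

end Nodes

/-! ## §B  Solver-free edges between the nodes -/

section Edges

variable {U : ℝ} {n : ℕ} {ν lo lo' : ℚ}

/-- A node survives a SMALLER slot `lo' ≤ lo`. -/
theorem LTIChainNode.mono (h : LTIChainNode U n ν lo) (hlo : lo' ≤ lo) : LTIChainNode U n ν lo' :=
  fun ρ h1 h2 h3 h4 h5 h6 h7 => le_trans (by exact_mod_cast hlo) (h ρ h1 h2 h3 h4 h5 h6 h7)

/-- A node survives a smaller slot `lo' ≤ lo`. -/
theorem LTIChainKSDNNode.mono (h : LTIChainKSDNNode U n ν lo) (hlo : lo' ≤ lo) : LTIChainKSDNNode U n ν lo' :=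
  fun ρ h1 h2 h3 h4 h5 h6 h7 => le_trans (by exact_mod_cast hlo) (h ρ h1 h2 h3 h4 h5 h6 h7)

/-- A node survives a smaller slot `lo' ≤ lo`. -/
theorem EntChainNode.mono (h : EntChainNode U n ν lo) (hlo : lo' ≤ lo) : EntChainNode U n ν lo' :=
  fun ρ h1 h2 h3 h4 h5 h6 h7 h8 => le_trans (by exact_mod_cast hlo) (h ρ h1 h2 h3 h4 h5 h6 h7 h8)

/-- A node survives a smaller slot `lo' ≤ lo`. -/
theorem EntTLMChainNode.mono (h : EntTLMChainNode U n ν lo) (hlo : lo' ≤ lo) : EntTLMChainNode U n ν lo' :=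
  fun ρ h1 h2 h3 h4 h5 h6 h7 h8 => le_trans (by exact_mod_cast hlo) (h ρ h1 h2 h3 h4 h5 h6 h7 h8)

/-- An `lti(n)` certificate is an ENT certificate: the ENT node has one MORE antecedent (the entropy row). -/
theorem LTIChainNode.entChainNode (h : LTIChainNode U n ν lo) : EntChainNode U n ν lo :=
  fun ρ h1 h2 h3 h4 h5 h6 h7 _ => h ρ h1 h2 h3 h4 h5 h6 h7

/-- The `tl_marginal`-form node at filling `2ν` implies the mean-energy-form node at per-spin density `ν`: under the LTI row
`Re tr(toSpin (tlmDensity n) ρ) = Σ_σ Re tr(toSpin n_{0σ} ρ)` and `tr(toSpin (tlmObjective 1 U n) ρ) = tr(toSpin (Γ(incl) E_Φ) ρ)`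
(`Transport.trace_tlmDensity_eq_of_lti`, `Transport.trace_tlmObjective_eq_of_lti`). [cite: KullEtAl2024, §II.B eq. (locTIn)] -/
theorem EntTLMChainNode.entChainNode (h : EntTLMChainNode U n (2 * ν) lo) : EntChainNode U n ν lo := by
  intro ρ h1 h2 h3 h4 h5 h6 h7 h8
  have hd : ((toSpin (tlmDensity n) * ρ).trace).re = (((2 * ν : ℚ) : ℚ) : ℝ) := by
    rw [trace_tlmDensity_eq_of_lti n h3, Complex.re_sum, Fin.sum_univ_two, h5, h5]
    push_cast
    ring
  have := h ρ h1 h2 h3 h4 hd h6 h7 h8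
  rwa [trace_tlmObjective_eq_of_lti n 1 U h3] at this

end Edges

/-! ## §C  The cells BY NAME: thermodynamic limit (M1 rows of `Statement.lean`) and ring forms -/

section Cells

variable {U : ℝ} {n p q : ℕ} {ν lo : ℚ}

/-- `lti(n)` node at half filling (per-spin density `1/2`) ⇒ the M1 energy LOWER row `lo ≤ e₀(U)` (`U ≥ 0`). -/
theorem LTIChainNode.m1EnergyLowerRow (h : LTIChainNode U n (1 / 2) lo) (hU : 0 ≤ U) : M1EnergyLowerRow U lo :=
  lti_primal_chainWindow_energyDensity_ge 1 hU n fun ρ h1 h2 h3 h4 h5 h6 h7 =>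
    h ρ h1 h2 h3 h4 (fun σ => by rw [h5 σ]; push_cast; norm_num) h6 h7

/-- `lti(n)` node at per-spin density `ν = p/(2q)` ⇒ the M1 doped energy LOWER row at filling `p/q` (`1 ≤ q`, `p ≤ 2q`, `U ≥ 0`). -/
theorem LTIChainNode.m1DopedEnergyLowerRow (h : LTIChainNode U n ν lo) (hU : 0 ≤ U) (hq : 1 ≤ q) (hp : p ≤ 2 * q)
    (hν : ((ν : ℚ) : ℝ) = (p : ℝ) / (2 * (q : ℝ))) : M1DopedEnergyLowerRow U p q lo :=
  lti_primal_chainWindow_energyDensityAt_ge 1 hU hq hp n fun ρ h1 h2 h3 h4 h5 h6 h7 =>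
    h ρ h1 h2 h3 h4 (fun σ => by rw [h5 σ, hν]) h6 h7

/-- FORMAT-ltisdp node at total first-site density `1` ⇒ the M1 energy LOWER row (`U ≥ 0`). -/
theorem LTIChainKSDNNode.m1EnergyLowerRow (h : LTIChainKSDNNode U n 1 lo) (hU : 0 ≤ U) : M1EnergyLowerRow U lo :=
  lti_primal_chainWindow_energyDensity_ge_ksdn 1 hU n fun ρ h1 h2 h3 h4 h5 h6 h7 =>
    h ρ h1 h2 h3 h4 (by rw [h5]; push_cast; norm_num) h6 h7

/-- FORMAT-ltisdp node at total first-site density `ν = p/q` ⇒ the M1 doped energy LOWER row at filling `p/q`. -/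
theorem LTIChainKSDNNode.m1DopedEnergyLowerRow (h : LTIChainKSDNNode U n ν lo) (hU : 0 ≤ U) (hq : 1 ≤ q) (hp : p ≤ 2 * q)
    (hν : ((ν : ℚ) : ℝ) = (p : ℝ) / (q : ℝ)) : M1DopedEnergyLowerRow U p q lo :=
  lti_primal_chainWindow_energyDensityAt_ge_ksdn 1 hU hq hp n fun ρ h1 h2 h3 h4 h5 h6 h7 =>
    h ρ h1 h2 h3 h4 (by rw [h5, hν]) h6 h7

/-- ENT node at half filling (per-spin density `1/2`) ⇒ the M1 energy LOWER row (`U ≥ 0`). -/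
theorem EntChainNode.m1EnergyLowerRow (h : EntChainNode U n (1 / 2) lo) (hU : 0 ≤ U) : M1EnergyLowerRow U lo :=
  ent_primal_chainWindow_energyDensity_ge 1 hU n fun ρ h1 h2 h3 h4 h5 h6 h7 h8 =>
    h ρ h1 h2 h3 h4 (fun σ => by rw [h5 σ]; push_cast; norm_num) h6 h7 h8

/-- ENT node at per-spin density `ν = p/(2q)` ⇒ the M1 doped energy LOWER row at filling `p/q`. -/
theorem EntChainNode.m1DopedEnergyLowerRow (h : EntChainNode U n ν lo) (hU : 0 ≤ U) (hq : 1 ≤ q) (hp : p ≤ 2 * q)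
    (hν : ((ν : ℚ) : ℝ) = (p : ℝ) / (2 * (q : ℝ))) : M1DopedEnergyLowerRow U p q lo :=
  ent_primal_chainWindow_energyDensityAt_ge 1 hU hq hp n fun ρ h1 h2 h3 h4 h5 h6 h7 h8 =>
    h ρ h1 h2 h3 h4 (fun σ => by rw [h5 σ, hν]) h6 h7 h8

/-- **ENT node in `tl_marginal` form at filling `1` ⇒ the M1 energy LOWER row `lo ≤ e₀(U)`** (`U ≥ 0`) — the cell of op-08's
`G`-free `k = n + 3` ENT certificates (LEAD r115). -/
theorem EntTLMChainNode.m1EnergyLowerRow (h : EntTLMChainNode U n 1 lo) (hU : 0 ≤ U) : M1EnergyLowerRow U lo :=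
  ent_tlm_chainWindow_energyDensity_ge 1 hU n fun ρ h1 h2 h3 h4 h5 h6 h7 h8 =>
    h ρ h1 h2 h3 h4 (by rw [h5]; push_cast; norm_num) h6 h7 h8

/-- ENT node in `tl_marginal` form at filling `ν = p/q` ⇒ the M1 doped energy LOWER row at filling `p/q`. -/
theorem EntTLMChainNode.m1DopedEnergyLowerRow (h : EntTLMChainNode U n ν lo) (hU : 0 ≤ U) (hq : 1 ≤ q) (hp : p ≤ 2 * q)
    (hν : ((ν : ℚ) : ℝ) = (p : ℝ) / (q : ℝ)) : M1DopedEnergyLowerRow U p q lo :=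
  ent_tlm_chainWindow_energyDensityAt_ge 1 hU hq hp n fun ρ h1 h2 h3 h4 h5 h6 h7 h8 =>
    h ρ h1 h2 h3 h4 (by rw [h5, hν]) h6 h7 h8

variable {L : ℕ} [NeZero L] {nh : ℕ}

/-- RING form of the ENT node (no `U ≥ 0` needed): `lo ≤ E₀(ring L, N = 2nh)/L` on every ring `L ≥ 3` with `nh ≤ L` electrons per
spin, `x ↦ x mod L` injective on `{-1, …, 2n+3}`, when the node's per-spin density is `ν = nh/L`. In particular a typed slot is
never larger than a ring energy per site (NON-VACUITY of the node, `Transport.exists_lti_ent_feasible_chainWindow`). -/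
theorem EntChainNode.le_energyPerSite (h : EntChainNode U n ν lo) (hL : 3 ≤ L) (hn : nh ≤ L)
    (hInj : Set.InjOn (Torus.proj (d := 1) L) ↑(chainWindow (-1) (2 * (n : ℤ) + 3)))
    (hν : ((ν : ℚ) : ℝ) = (nh : ℝ) / (L : ℝ)) :
    ((lo : ℚ) : ℝ) ≤ energyPerSite (hubbardChain L) 1 U (2 * nh) :=
  ent_primal_chainWindow_energyPerSite_ge 1 U n hL hn hInj hν h

/-- RING form of the `tl_marginal` ENT node: `lo ≤ E₀(ring L, N = 2nh)/L` when the node's filling is `ν = 2nh/L`. -/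
theorem EntTLMChainNode.le_energyPerSite (h : EntTLMChainNode U n ν lo) (hL : 3 ≤ L) (hn : nh ≤ L)
    (hInj : Set.InjOn (Torus.proj (d := 1) L) ↑(chainWindow (-1) (2 * (n : ℤ) + 3)))
    (hν : ((ν : ℚ) : ℝ) = 2 * (nh : ℝ) / (L : ℝ)) :
    ((lo : ℚ) : ℝ) ≤ energyPerSite (hubbardChain L) 1 U (2 * nh) :=
  ent_tlm_chainWindow_energyPerSite_ge 1 U n hL hn hInj hν h

/-- RING form of the `lti(n)` node (via `LTIChainNode.entChainNode`). -/
theorem LTIChainNode.le_energyPerSite (h : LTIChainNode U n ν lo) (hL : 3 ≤ L) (hn : nh ≤ L)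
    (hInj : Set.InjOn (Torus.proj (d := 1) L) ↑(chainWindow (-1) (2 * (n : ℤ) + 3)))
    (hν : ((ν : ℚ) : ℝ) = (nh : ℝ) / (L : ℝ)) :
    ((lo : ℚ) : ℝ) ≤ energyPerSite (hubbardChain L) 1 U (2 * nh) :=
  h.entChainNode.le_energyPerSite hL hn hInj hν

end Cells

end Summit.Ventures.CertifiedManyBodySolver
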